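import Summits.BirchSwinnertonDyer.BirchSwinnertonDyer.Theorems.ResidualThetaTransportAtTwoResidualSignedLambdaLowerCMAtTwoSelfDualTower
import Literature.NumberTheory.EllipticCurves.PadicCoeffIntegersFrobeniusData
import Literature.NumberTheory.EllipticCurves.GreenbergSelmerCharIdealPrincipalProofs
import HarnessLib

/-!
# K-a2: a GENERATOR `t₀` of `Hom_{ℤ_p}(𝒪, ℤ_p)` for `𝒪 = padicCoeffIntegers S` (Frobenius data `ℤ_p → 𝒪`), and the PERFECTNESS of the
# self-duality tower `e_k` of p675174 at `λ := t₀` (every `𝒪`, ramified or not)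

Route `ResidualThetaTransportAtTwo` (RTT), crux RSL_g `ResidualSignedLambdaLowerCMAtTwo` (stmt-BirchSwinnertonDyer-22608); seat `prover-bsd-wall-rtt-p2` g17
(`--supports`, closes nothing). THEOREMS ONLY (no definition, no named fact, no instance, no `sorry`). BSD is not proved by any of this; RSL_g is
not proved here. Item K-a2 / Q47 of STUB-PLAN rev 11 (S43: «`lam := t₀` a generator of `Hom_{ℤ₂}(𝒪, ℤ₂)`, never the trace» — for a RAMIFIED
coefficient ring the trace form is degenerate mod `ϖ`, T28).

WHAT.
* §1 **`exists_dualGenerator`** — for `ℚ_p(S)/ℚ_p` finite there are a `ℤ_p`-linear `t₀ : 𝒪 →+ ℤ_p` and mutually `t₀`-dual finite families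
  `b, b' : Fin n → 𝒪` with `a = Σ_i t₀(a b'_i) b_i = Σ_i t₀(a b_i) b'_i` for every `a ∈ 𝒪` — the tree's Frobenius data for the unit ball
  (`exists_frobeniusData_unitBall`: the inverse different of `𝒪/ℤ_p` is principal, Serre LF III §3) transported along
  `padicCoeffIntegers S = unitBall p ℚ_p(S)` (`padicCoeffIntegers_eq_unitBall`), in the `→+`/`padicIntToCoeffIntegers` dialect of
  `ThetaTransport.exists_cofreeWedgeTower` (whose `lam` slot it fills). Consequences: `eq_zero_of_forall_dualGenerator_mul`
  (`t₀(a𝒪) = 0 ⇒ a = 0`) and **`mem_span_pow_of_forall_toZModPow_dualGenerator_mul`** (`t₀(a𝒪) ⊆ p^k ℤ_p ⇒ a ∈ p^k 𝒪`).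
* §2 **`wedge_eq_zero_of_forall_eq_one_left` / `…_right`** — PERFECTNESS of the tower `e_k` on `A_ρ[p^k] × A_ρ[p^k]` whenever its value
  formula is `e_k(p^{-k}s, p^{-k}t) = ζ_k^{t₀(s ∧ t) mod p^k}` with `ζ_k` PRIMITIVE and `t₀` as in §1: `e_k(a, ·) ≡ 1 ⇒ a = 0` and
  `e_k(·, b) ≡ 1 ⇒ b = 0` (test against `p^{-k}(0, x)` and `p^{-k}(x, 0)`, then §1 and `divPowCofreeMk_eq_zero_iff`).

References: [SerreLocalFields1979] Ch. III §3 (p. 50), §2 Prop. 4; [NeukirchANT1999] Ch. II (4.8); [Kato2004Asterisque] §14.9 (p. 239);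
[Nekovar2006] §0.11.
-/

set_option autoImplicit false
-- the Theorems namespace of this sub repeats the summit name by design (D-0017 nested layout)
set_option linter.dupNamespace false

noncomputable section

open scoped Classical

namespace Summit.BirchSwinnertonDyer.BirchSwinnertonDyer.Theorems.ThetaTransport

open NumberField Field IsDedekindDomain Literature.NumberTheory.EllipticCurves Literature.NumberTheory.EllipticCurves.GreenbergSelmer
  Literature.NumberTheory.GaloisRepresentations Literature.NumberTheory.Automorphic

/-! ## §1 Frobenius data `ℤ_p → 𝒪` on the carrier `padicCoeffIntegers S` -/

section Frobenius

variable {p : ℕ} [Fact p.Prime] (S : Set (PadicAlgCl p))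

/-- The identity-on-elements ring isomorphism `padicCoeffIntegers S ≃+* unitBall p ℚ_p(S)` carries `padicIntToCoeffIntegers` to the
`ℤ_p`-algebra structure map of the unit ball (both are `ℤ_p ⊆ ℚ_p ⊆ ℚ̄_p` corestricted). [cite: NeukirchANT1999, Ch. II (4.8)] -/
theorem subringCongr_padicIntToCoeffIntegers (z : ℤ_[p]) :
    RingEquiv.subringCongr (padicCoeffIntegers_eq_unitBall S) (padicIntToCoeffIntegers S z) =
      algebraMap ℤ_[p] (PadicIntermediateField.unitBall p (padicCoeffField S)) z := by
  apply Subtype.ext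
  change ((padicIntToCoeffIntegers S z : padicCoeffIntegers S) : PadicAlgCl p) = algebraMap ℤ_[p] (PadicAlgCl p) z
  rw [coe_padicIntToCoeffIntegers, IsScalarTower.algebraMap_apply ℤ_[p] ℚ_[p] (PadicAlgCl p)]
  rfl

/-- **K-a2: a generator of `Hom_{ℤ_p}(𝒪, ℤ_p)` (Frobenius data for `ℤ_p → 𝒪 = padicCoeffIntegers S`).** For `ℚ_p(S)/ℚ_p` finite there
are a `ℤ_p`-linear additive `t₀ : 𝒪 → ℤ_p` and finite families `b, b' : Fin n → 𝒪` with the two dual-basis expansions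
`a = Σ_i t₀(a·b'_i)·b_i = Σ_i t₀(a·b_i)·b'_i` (scalars through `padicIntToCoeffIntegers`). Equivalently `Hom_{ℤ_p}(𝒪, ℤ_p) = 𝒪·t₀` is free of
rank one (the inverse different is principal); `(a, x) ↦ t₀(ax)` is a perfect `ℤ_p`-bilinear form on `𝒪` — for EVERY `𝒪`, ramified or not
(the trace is such a generator only in the unramified case). Source: the tree's `exists_frobeniusData_unitBall` transported along
`padicCoeffIntegers_eq_unitBall`. [cite: SerreLocalFields1979, Ch. III §3 (p. 50) and §2 Prop. 4] [cite: NeukirchANT1999, Ch. II (4.8)] -/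
theorem exists_dualGenerator [FiniteDimensional ℚ_[p] (padicCoeffField S)] :
    ∃ (t₀ : ↥(padicCoeffIntegers S) →+ ℤ_[p]) (n : ℕ) (b b' : Fin n → ↥(padicCoeffIntegers S)),
      (∀ (z : ℤ_[p]) (x : ↥(padicCoeffIntegers S)), t₀ (padicIntToCoeffIntegers S z * x) = z * t₀ x) ∧
      (∀ a : ↥(padicCoeffIntegers S), a = ∑ i, padicIntToCoeffIntegers S (t₀ (a * b' i)) * b i) ∧
      (∀ a : ↥(padicCoeffIntegers S), a = ∑ i, padicIntToCoeffIntegers S (t₀ (a * b i)) * b' i) := by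
  set e : ↥(padicCoeffIntegers S) ≃+* ↥(PadicIntermediateField.unitBall p (padicCoeffField S)) :=
    RingEquiv.subringCongr (padicCoeffIntegers_eq_unitBall S) with he
  obtain ⟨n, t, b, b', hb, hb'⟩ := exists_frobeniusData_unitBall p (padicCoeffField S)
  have hι : ∀ z : ℤ_[p], e (padicIntToCoeffIntegers S z) = algebraMap ℤ_[p] _ z := subringCongr_padicIntToCoeffIntegers S
  -- pull an expansion `y = Σ t(y c'_i) • c_i` in the unit ball back to `𝒪`
  have hpull : ∀ (c c' : Fin n → ↥(PadicIntermediateField.unitBall p (padicCoeffField S))),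
      (∀ y, y = ∑ i, t (y * c' i) • c i) →
      ∀ a : ↥(padicCoeffIntegers S), a = ∑ i, padicIntToCoeffIntegers S (t (e (a * e.symm (c' i)))) * e.symm (c i) := by
    intro c c' hc a
    apply e.injective
    rw [map_sum]
    conv_lhs => rw [hc (e a)]
    refine Finset.sum_congr rfl fun i _ => ?_
    rw [map_mul e, hι, map_mul e, RingEquiv.apply_symm_apply, RingEquiv.apply_symm_apply, Algebra.smul_def]
  refine ⟨t.toAddMonoidHom.comp e.toAddMonoidHom, n, fun i => e.symm (b i), fun i => e.symm (b' i), fun z x => ?_,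
    hpull b b' hb, hpull b' b hb'⟩
  change t (e (padicIntToCoeffIntegers S z * x)) = z * t (e x)
  rw [map_mul e, hι, ← Algebra.smul_def, map_smul, smul_eq_mul]

variable {S}

/-- `t₀(a·𝒪) = 0 ⇒ a = 0` (non-degeneracy of `(a, x) ↦ t₀(ax)`), from the dual-basis expansion. [cite: SerreLocalFields1979, Ch. III §3 (p. 50)] -/
theorem eq_zero_of_forall_dualGenerator_mul {t₀ : ↥(padicCoeffIntegers S) →+ ℤ_[p]} {n : ℕ} {b b' : Fin n → ↥(padicCoeffIntegers S)}
    (hb : ∀ a : ↥(padicCoeffIntegers S), a = ∑ i, padicIntToCoeffIntegers S (t₀ (a * b' i)) * b i)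
    (a : ↥(padicCoeffIntegers S)) (h : ∀ x, t₀ (a * x) = 0) : a = 0 := by
  rw [hb a]
  exact Finset.sum_eq_zero fun i _ => by rw [h, map_zero, zero_mul]

/-- **`t₀(a·𝒪) ⊆ p^k ℤ_p ⇒ a ∈ p^k 𝒪`** (perfectness of `(a, x) ↦ t₀(ax)` modulo `p^k`; residues read by `PadicInt.toZModPow k`), from the
dual-basis expansion. [cite: SerreLocalFields1979, Ch. III §3 (p. 50)] [cite: Kato2004Asterisque, §14.9 (p. 239)] -/
theorem mem_span_pow_of_forall_toZModPow_dualGenerator_mul {t₀ : ↥(padicCoeffIntegers S) →+ ℤ_[p]} {n : ℕ}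
    {b b' : Fin n → ↥(padicCoeffIntegers S)}
    (hb : ∀ a : ↥(padicCoeffIntegers S), a = ∑ i, padicIntToCoeffIntegers S (t₀ (a * b' i)) * b i)
    (k : ℕ) (a : ↥(padicCoeffIntegers S)) (h : ∀ x, PadicInt.toZModPow k (t₀ (a * x)) = 0) :
    a ∈ Ideal.span {((p : ↥(padicCoeffIntegers S))) ^ k} := by
  rw [hb a]
  refine Ideal.sum_mem _ fun i _ => ?_
  have hmem : t₀ (a * b' i) ∈ Ideal.span {((p : ℤ_[p])) ^ k} := by
    rw [← PadicInt.ker_toZModPow]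
    exact h (b' i)
  obtain ⟨c, hc⟩ := Ideal.mem_span_singleton'.mp hmem
  rw [← hc, map_mul, map_pow, map_natCast]
  exact Ideal.mul_mem_right _ _ (Ideal.mul_mem_left _ _ (Ideal.mem_span_singleton_self _))

end Frobenius

/-! ## §2 Perfectness of the wedge tower `e_k` at `λ := t₀` -/

section Perfect

variable {p : ℕ} [Fact p.Prime] {S : Set (PadicAlgCl p)} (ρ : FramedGaloisRep ℚ ↥(padicCoeffIntegers S) 2)
  {t₀ : ↥(padicCoeffIntegers S) →+ ℤ_[p]} {n : ℕ} {b b' : Fin n → ↥(padicCoeffIntegers S)}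
  (hb : ∀ a : ↥(padicCoeffIntegers S), a = ∑ i, padicIntToCoeffIntegers S (t₀ (a * b' i)) * b i)
  {ePk : ∀ k : ℕ, ↥(AddSubgroup.torsionBy (Cofree ρ ↥(padicCoeffField S)) ((p ^ k : ℕ) : ℤ)) →
    ↥(AddSubgroup.torsionBy (Cofree ρ ↥(padicCoeffField S)) ((p ^ k : ℕ) : ℤ)) → AlgebraicClosure ℚ}
  {ζ : ℕ → AlgebraicClosure ℚ} (hζ : ∀ k, IsPrimitiveRoot (ζ k) (p ^ k))
  (hval : ∀ k (s t : Fin 2 → ↥(padicCoeffIntegers S)),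
    ePk k (divPowCofreeMkTorsion S ρ k s) (divPowCofreeMkTorsion S ρ k t) = ζ k ^ (PadicInt.toZModPow k (t₀ (s 0 * t 1 - s 1 * t 0))).val)

include hζ in
/-- `ζ_k^{x.val} = 1 ⇒ x = 0` in `ZMod p^k` for `ζ_k` primitive of order `p^k`. [cite: Nekovar2006, §0.11] -/
theorem zmod_eq_zero_of_pow_val_eq_one (k : ℕ) (x : ZMod (p ^ k)) (hx : ζ k ^ x.val = 1) : x = 0 := by
  haveI : NeZero (p ^ k) := ⟨pow_ne_zero k (Fact.out : p.Prime).ne_zero⟩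
  have hdvd : p ^ k ∣ x.val := (hζ k).dvd_of_pow_eq_one _ hx
  have hlt : x.val < p ^ k := ZMod.val_lt x
  have h0 : x.val = 0 := Nat.eq_zero_of_dvd_of_lt hdvd hlt
  exact (ZMod.val_eq_zero x).mp h0

include hb hζ hval in
/-- **Perfectness of `e_k`, left**: if `e_k(a, b) = 1` for all `b ∈ A_ρ[p^k]` then `a = 0`. With `a = p^{-k}s`: testing against
`p^{-k}(0, x)` and `p^{-k}(x, 0)` gives `t₀(s₀ x), t₀(s₁ x) ∈ p^k ℤ_p` for all `x`, so `s ∈ p^k 𝒪²` (§1) and `a = 0`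
(`divPowCofreeMk_eq_zero_iff`). [cite: Kato2004Asterisque, §14.9 (p. 239)] [cite: SerreLocalFields1979, Ch. III §3 (p. 50)] -/
theorem wedge_eq_zero_of_forall_eq_one_left (k : ℕ) (a : ↥(AddSubgroup.torsionBy (Cofree ρ ↥(padicCoeffField S)) ((p ^ k : ℕ) : ℤ)))
    (h : ∀ c, ePk k a c = 1) : a = 0 := by
  obtain ⟨s, rfl⟩ := divPowCofreeMkTorsion_surjective S ρ k a
  apply Subtype.ext
  rw [coe_divPowCofreeMkTorsion_apply, ZeroMemClass.coe_zero, divPowCofreeMk_eq_zero_iff]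
  have hkill : ∀ j : Fin 2, ∀ x, PadicInt.toZModPow k (t₀ (s j * x)) = 0 := by
    intro j x
    fin_cases j
    · -- test against `(0, x)`: `s ∧ (0, x) = s₀ x`
      have h1 := h (divPowCofreeMkTorsion S ρ k (Pi.single 1 x))
      rw [hval] at h1
      have h2 := zmod_eq_zero_of_pow_val_eq_one hζ k _ h1
      simpa using h2
    · -- test against `(x, 0)`: `s ∧ (x, 0) = -(s₁ x)`
      have h1 := h (divPowCofreeMkTorsion S ρ k (Pi.single 0 x))
      rw [hval] at h1
      have h2 := zmod_eq_zero_of_pow_val_eq_one hζ k _ h1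
      simp only [Fin.isValue, Pi.single_eq_same, ne_eq, one_ne_zero, not_false_eq_true, Pi.single_eq_of_ne, mul_zero,
        zero_sub, map_neg, neg_eq_zero] at h2
      simpa using h2
  intro j
  exact mem_span_pow_of_forall_toZModPow_dualGenerator_mul hb k (s j) (hkill j)

include hb hζ hval in
/-- **Perfectness of `e_k`, right**: if `e_k(a, c) = 1` for all `a` then `c = 0` (test against `p^{-k}(x, 0)` and `p^{-k}(0, x)`).
[cite: Kato2004Asterisque, §14.9 (p. 239)] [cite: SerreLocalFields1979, Ch. III §3 (p. 50)] -/
theorem wedge_eq_zero_of_forall_eq_one_right (k : ℕ) (c : ↥(AddSubgroup.torsionBy (Cofree ρ ↥(padicCoeffField S)) ((p ^ k : ℕ) : ℤ)))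
    (h : ∀ a, ePk k a c = 1) : c = 0 := by
  obtain ⟨t, rfl⟩ := divPowCofreeMkTorsion_surjective S ρ k c
  apply Subtype.ext
  rw [coe_divPowCofreeMkTorsion_apply, ZeroMemClass.coe_zero, divPowCofreeMk_eq_zero_iff]
  have hkill : ∀ j : Fin 2, ∀ x, PadicInt.toZModPow k (t₀ (t j * x)) = 0 := by
    intro j x
    fin_cases j
    · -- test against `(0, x)` on the left: `(0, x) ∧ t = -(x t₀)`
      have h1 := h (divPowCofreeMkTorsion S ρ k (Pi.single 1 x))
      rw [hval] at h1
      have h2 := zmod_eq_zero_of_pow_val_eq_one hζ k _ h1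
      simpa [mul_comm] using h2
    · -- test against `(x, 0)` on the left: `(x, 0) ∧ t = x t₁`
      have h1 := h (divPowCofreeMkTorsion S ρ k (Pi.single 0 x))
      rw [hval] at h1
      have h2 := zmod_eq_zero_of_pow_val_eq_one hζ k _ h1
      simpa [mul_comm] using h2
  intro j
  exact mem_span_pow_of_forall_toZModPow_dualGenerator_mul hb k (t j) (hkill j)

end Perfect

end Summit.BirchSwinnertonDyer.BirchSwinnertonDyer.Theorems.ThetaTransport

end
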